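import Summits.BirchSwinnertonDyer.BirchSwinnertonDyer.Theorems.ResidualThetaTransportAtTwoThetaTransportThetaIndependence
import Literature.NumberTheory.EllipticCurves.GreenbergSelmerDualDataExistsProofs
import HarnessLib

/-!
# The transported local clause at `2` is an `𝒪`-stable subgroup condition (crux (R≥)ᵖ `ResidualThetaCountLowerPureAtTwo`,
# line «bt26-lambda», stubs `stub_transport` / S2 `stub_cmLambdaLower`)

Route `ResidualThetaTransportAtTwo` (RTT), crux (R≥)ᵖ `ResidualThetaCountLowerPureAtTwo` (stmt-BirchSwinnertonDyer-26074),
line «bt26-lambda»; seat `prover-bsd-rtt-w3` g0 (width helper, `--supports`, closes nothing). HONEST FRAMING: THEOREMS ONLY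
(no definition, no named fact, no instance, no `sorry`); the `𝒪`-stability statements are CONDITIONAL on the route's print
binder `SerreSupersingularDecompositionImageInput` (Serre 1972 Prop. 12, item stmt-BirchSwinnertonDyer-27793), hypothesis `hSe`,
exactly like `…IntegralSchurAtTwo`; BSD is not proved by any of this.

WHY. The `g`-side counted set of S2 is written as a SET-BUILDER (the line posits no definition). Any λ-argument for S2
(Pontryagin dual `X_g`, `Λ_𝒪`-structure, `#Sel[ϖ] = #X_g/ϖ`) first needs that set to be the `ϖ`-torsion of an
`𝒪`-SUBMODULE of `H¹(Γ_{ℚ_∞}, A_g)`. The unramified / archimedean / `ϖ`-torsion clauses are subgroup conditions of the tree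
(`unramifiedOutside`, `infKer`, `scalarH1`); this file supplies the same for the TRANSPORTED KUMMER CLAUSE at `v ∣ 2`
`C_Θ(c) :≡ ∃ φ Q k, [φ] = c ∧ (∀ i, 2ᵏQ_i ∈ L) ∧ ∀ τ ∈ H_v, ∀ i, Θ(φ τ)_i = τQ_i − Q_i` (`Θ : A ≃+ (W[2^∞])ⁿ` a local transport
datum, `L` any subgroup of local points, `H ≤ Γ_ℚ`):
* `kummerClause_map_of_kummerClause` — transfer of the finite-level clause from `Θ` to ANY additive `D_v`-equivariant
  `Ψ : A → (W[2^∞])ⁿ'` (integral Schur: `Ψ ∘ Θ⁻¹` is an integer matrix on finite layers; generalises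
  `kummerClause_of_kummerClause`, where `Ψ` was a second datum);
* `transportedKummer_zero`, `transportedKummer_add`, `transportedKummer_neg`, **`exists_addSubgroup_transportedKummer`** —
  `C_Θ` is a subgroup condition (as for the tree's `Kobayashi2003.localKummerOverOfEmb`), also in the crux's `∀ σ, C_Θ(conj_σ y)` form;
* **`transportedKummer_scalarH1`** — `𝒪`-STABILITY (granted Serre): for scalars `r` of `A` commuting with `Γ_ℚ`,
  `C_Θ(c) → C_Θ(scalarH1 r c)` (`[r • φ]`, `Q' = C·Q` with `C` the integer matrix of `Θ ∘ (r•) ∘ Θ⁻¹`), and the `conj_σ` form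
  (`conjH1_comp_scalarH1`).

References: [SerreInventiones1972] §1.11 Prop. 12, §2.2; [Kobayashi2003] Def. 1.1; [EmertonPollackWeston2006] §3.1;
[SerreGaloisCohomology1997] I §2.2, I §5.1.
-/

set_option autoImplicit false
-- the Theorems namespace of this sub repeats the summit name by design (D-0017 nested layout)
set_option linter.dupNamespace false

noncomputable section

open scoped AddSubgroup
open WeierstrassCurve NumberField Field IsDedekindDomain Literature Literature.NumberTheory.EllipticCurves
  Literature.NumberTheory.EllipticCurves.GreenbergSelmer Literature.NumberTheory.GaloisRepresentations
  Literature.NumberTheory.EllipticCurves.Rank1Residual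

namespace Summit.BirchSwinnertonDyer.BirchSwinnertonDyer.Theorems.ThetaTransport

variable (W : WeierstrassCurve ℚ) [W.IsElliptic] [W.IsGloballyMinimal]
  {A : Type} [AddCommGroup A] [DistribMulAction (absoluteGaloisGroup ℚ) A]

/-! ### §1. Transfer of the clause along any equivariant additive map -/

/-- **Transfer of the Kummer clause along an equivariant additive map** (granted Serre 1972 Prop. 12). On the habitat, `v ∣ 2`:
for a datum `Θ : A ≃+ (W[2^∞])ⁿ` and ANY additive `Ψ : A → (W[2^∞])ⁿ'`, both commuting coordinatewise with the decomposition group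
at `v`, finitely-valued `a : T → A`, `g : T → Γ_{ℚ_v}`, `L` a subgroup of local points: if `Θ(a t)_i = g_t Q_i − Q_i` with `2ᵏQ_i ∈ L`,
then `Ψ(a t)_i = g_t Q'_i − Q'_i` with `2ᵏQ'_i ∈ L`, `Q' = C·Q` for the integer matrix `C` of `Ψ ∘ Θ⁻¹` on the finite layer carrying
all `Θ(a t)`. [cite: SerreInventiones1972, §1.11 Prop. 12; §2.2] [cite: Kobayashi2003, Def. 1.1] -/
theorem kummerClause_map_of_kummerClause (hSe : serre1972_supersingular_decompositionSubgroup_image)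
    (hss : GoodSS W 2) (ha2 : W.frobeniusTrace 2 = 0) (v : HeightOneSpectrum (𝓞 ℚ)) (hv : ((2 : ℕ) : 𝓞 ℚ) ∈ v.asIdeal)
    {n n' : ℕ} (Θ : A ≃+ (Fin n → ↥(W.geomPrimaryTorsion 2))) (Ψ : A →+ (Fin n' → ↥(W.geomPrimaryTorsion 2)))
    (hΘ : ∀ (δ : absoluteGaloisGroup (v.adicCompletion ℚ)) (m : A) (i : Fin n),
      Θ (resGalOfEmb (closureEmb (K := ℚ) (v.adicCompletion ℚ)) δ • m) i =
        resGalOfEmb (closureEmb (K := ℚ) (v.adicCompletion ℚ)) δ • Θ m i)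
    (hΨ : ∀ (δ : absoluteGaloisGroup (v.adicCompletion ℚ)) (m : A) (i : Fin n'),
      Ψ (resGalOfEmb (closureEmb (K := ℚ) (v.adicCompletion ℚ)) δ • m) i =
        resGalOfEmb (closureEmb (K := ℚ) (v.adicCompletion ℚ)) δ • Ψ m i)
    {T : Type} (a : T → A) (hfin : (Set.range a).Finite) (g : T → absoluteGaloisGroup (v.adicCompletion ℚ))
    (L : AddSubgroup (localPoints W (v.adicCompletion ℚ)))
    (h : ∃ (Q : Fin n → localPoints W (v.adicCompletion ℚ)) (k : ℕ), (∀ i, (2 ^ k) • Q i ∈ L) ∧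
      ∀ t i, pointsMapOfEmb W (closureEmb (K := ℚ) (v.adicCompletion ℚ)) ((Θ (a t) i : ↥(W.geomPrimaryTorsion 2)) : W.geomPoints) =
        g t • Q i - Q i) :
    ∃ (Q' : Fin n' → localPoints W (v.adicCompletion ℚ)) (k : ℕ), (∀ i, (2 ^ k) • Q' i ∈ L) ∧
      ∀ t i, pointsMapOfEmb W (closureEmb (K := ℚ) (v.adicCompletion ℚ)) ((Ψ (a t) i : ↥(W.geomPrimaryTorsion 2)) : W.geomPoints) =
        g t • Q' i - Q' i := by
  obtain ⟨Q, k, hQ, hId⟩ := h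
  obtain ⟨Φ, hΦ⟩ : ∃ Φ : (Fin n → ↥(W.geomPrimaryTorsion 2)) →+ (Fin n' → ↥(W.geomPrimaryTorsion 2)),
      ∀ x, Φ x = Ψ (Θ.symm x) :=
    ⟨Ψ.comp (Θ.symm : (Fin n → ↥(W.geomPrimaryTorsion 2)) →+ A), fun _ ↦ rfl⟩
  have hsymm : ∀ (δ : absoluteGaloisGroup (v.adicCompletion ℚ)) (x : Fin n → ↥(W.geomPrimaryTorsion 2)),
      Θ.symm (resGalOfEmb (closureEmb (K := ℚ) (v.adicCompletion ℚ)) δ • x) =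
        resGalOfEmb (closureEmb (K := ℚ) (v.adicCompletion ℚ)) δ • Θ.symm x := fun δ x ↦ by
    apply Θ.injective
    rw [Θ.apply_symm_apply]
    funext i
    rw [hΘ, Θ.apply_symm_apply, Pi.smul_apply]
  have hΦsmul : ∀ (δ : absoluteGaloisGroup (v.adicCompletion ℚ)) (x : Fin n → ↥(W.geomPrimaryTorsion 2)) (i : Fin n'),
      Φ (resGalOfEmb (closureEmb (K := ℚ) (v.adicCompletion ℚ)) δ • x) i =
        resGalOfEmb (closureEmb (K := ℚ) (v.adicCompletion ℚ)) δ • Φ x i := fun δ x i ↦ by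
    rw [hΦ, hΦ, hsymm, hΨ]
  obtain ⟨m, hm⟩ := exists_pow_nsmul_map_eq_zero_of_finite W Θ a hfin
  obtain ⟨C, hC⟩ := decomp_equivariant_addMonoidHom_pi_primary_eq_sum_nsmul W hSe hss ha2 v hv m Φ hΦsmul
  have hΨC : ∀ t i, Ψ (a t) i = ∑ l, C i l • Θ (a t) l := fun t i ↦ by
    rw [← hC (Θ (a t)) (hm t) i, hΦ, Θ.symm_apply_apply]
  refine ⟨fun i ↦ ∑ l, C i l • Q l, k, fun i ↦ ?_, fun t i ↦ ?_⟩
  · rw [Finset.smul_sum]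
    exact L.sum_mem fun l _ ↦ by rw [smul_comm]; exact L.nsmul_mem (hQ l) _
  · rw [hΨC, AddSubmonoidClass.coe_finsetSum, map_sum, smul_sum_nsmul_sub]
    refine Finset.sum_congr rfl fun l _ ↦ ?_
    rw [AddSubmonoidClass.coe_nsmul, map_nsmul, hId]

/-! ### §2. The clause is a subgroup condition -/

section Subgroup

variable [TopologicalSpace A] [DiscreteTopology A] (H : Subgroup (absoluteGaloisGroup ℚ))
  (v : HeightOneSpectrum (𝓞 ℚ)) {n : ℕ} (Θ : A ≃+ (Fin n → ↥(W.geomPrimaryTorsion 2)))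
  (L : AddSubgroup (localPoints W (v.adicCompletion ℚ)))

omit [W.IsElliptic] [W.IsGloballyMinimal] in
/-- The zero class satisfies the transported Kummer clause (`φ = 0`, `Q = 0`). [cite: Kobayashi2003, Def. 1.1] -/
theorem transportedKummer_zero :
    ∃ (φ : contOneCocycles (discreteTopRep H A)) (Q : Fin n → localPoints W (v.adicCompletion ℚ)) (k : ℕ),
      oneCocycleClass (discreteTopRep H A) φ = 0 ∧ (∀ i, (2 ^ k) • Q i ∈ L) ∧
      ∀ (τ : localSubgroupOfEmb H (closureEmb (K := ℚ) (v.adicCompletion ℚ))) (i : Fin n),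
        pointsMapOfEmb W (closureEmb (K := ℚ) (v.adicCompletion ℚ))
          ((Θ (φ.1 (resGalSubgroupOfEmb H (closureEmb (K := ℚ) (v.adicCompletion ℚ)) τ)) i : ↥(W.geomPrimaryTorsion 2)) :
            W.geomPoints) = (τ : absoluteGaloisGroup (v.adicCompletion ℚ)) • Q i - Q i := by
  refine ⟨0, 0, 0, oneCocycleClass_zero _, fun i ↦ by rw [Pi.zero_apply, smul_zero]; exact L.zero_mem, fun τ i ↦ ?_⟩
  rw [Submodule.coe_zero, ContinuousMap.zero_apply, map_zero, Pi.zero_apply, ZeroMemClass.coe_zero, map_zero, Pi.zero_apply,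
    smul_zero, sub_zero]

omit [W.IsElliptic] [W.IsGloballyMinimal] in
/-- The transported Kummer clause is stable under sums (`φ₁ + φ₂`, `Q₁ + Q₂`, `k₁ + k₂`). [cite: Kobayashi2003, Def. 1.1] -/
theorem transportedKummer_add (c₁ c₂ : subgroupH1 H A)
    (h₁ : ∃ (φ : contOneCocycles (discreteTopRep H A)) (Q : Fin n → localPoints W (v.adicCompletion ℚ)) (k : ℕ),
      oneCocycleClass (discreteTopRep H A) φ = c₁ ∧ (∀ i, (2 ^ k) • Q i ∈ L) ∧
      ∀ (τ : localSubgroupOfEmb H (closureEmb (K := ℚ) (v.adicCompletion ℚ))) (i : Fin n),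
        pointsMapOfEmb W (closureEmb (K := ℚ) (v.adicCompletion ℚ))
          ((Θ (φ.1 (resGalSubgroupOfEmb H (closureEmb (K := ℚ) (v.adicCompletion ℚ)) τ)) i : ↥(W.geomPrimaryTorsion 2)) :
            W.geomPoints) = (τ : absoluteGaloisGroup (v.adicCompletion ℚ)) • Q i - Q i)
    (h₂ : ∃ (φ : contOneCocycles (discreteTopRep H A)) (Q : Fin n → localPoints W (v.adicCompletion ℚ)) (k : ℕ),
      oneCocycleClass (discreteTopRep H A) φ = c₂ ∧ (∀ i, (2 ^ k) • Q i ∈ L) ∧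
      ∀ (τ : localSubgroupOfEmb H (closureEmb (K := ℚ) (v.adicCompletion ℚ))) (i : Fin n),
        pointsMapOfEmb W (closureEmb (K := ℚ) (v.adicCompletion ℚ))
          ((Θ (φ.1 (resGalSubgroupOfEmb H (closureEmb (K := ℚ) (v.adicCompletion ℚ)) τ)) i : ↥(W.geomPrimaryTorsion 2)) :
            W.geomPoints) = (τ : absoluteGaloisGroup (v.adicCompletion ℚ)) • Q i - Q i) :
    ∃ (φ : contOneCocycles (discreteTopRep H A)) (Q : Fin n → localPoints W (v.adicCompletion ℚ)) (k : ℕ),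
      oneCocycleClass (discreteTopRep H A) φ = c₁ + c₂ ∧ (∀ i, (2 ^ k) • Q i ∈ L) ∧
      ∀ (τ : localSubgroupOfEmb H (closureEmb (K := ℚ) (v.adicCompletion ℚ))) (i : Fin n),
        pointsMapOfEmb W (closureEmb (K := ℚ) (v.adicCompletion ℚ))
          ((Θ (φ.1 (resGalSubgroupOfEmb H (closureEmb (K := ℚ) (v.adicCompletion ℚ)) τ)) i : ↥(W.geomPrimaryTorsion 2)) :
            W.geomPoints) = (τ : absoluteGaloisGroup (v.adicCompletion ℚ)) • Q i - Q i := by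
  obtain ⟨φ₁, Q₁, k₁, hc₁, hQ₁, hτ₁⟩ := h₁
  obtain ⟨φ₂, Q₂, k₂, hc₂, hQ₂, hτ₂⟩ := h₂
  refine ⟨φ₁ + φ₂, Q₁ + Q₂, k₁ + k₂, by rw [oneCocycleClass_add, hc₁, hc₂], fun i ↦ ?_, fun τ i ↦ ?_⟩
  · rw [Pi.add_apply, smul_add]
    exact L.add_mem (pow_nsmul_mem_of_le L (hQ₁ i) (Nat.le_add_right k₁ k₂))
      (pow_nsmul_mem_of_le L (hQ₂ i) (Nat.le_add_left k₂ k₁))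
  · rw [Submodule.coe_add, ContinuousMap.add_apply, map_add, Pi.add_apply, AddSubgroup.coe_add, map_add, hτ₁, hτ₂,
      Pi.add_apply, smul_add]
    abel

omit [W.IsElliptic] [W.IsGloballyMinimal] in
/-- The transported Kummer clause is stable under negation (`−φ`, `−Q`). [cite: Kobayashi2003, Def. 1.1] -/
theorem transportedKummer_neg (c : subgroupH1 H A)
    (h : ∃ (φ : contOneCocycles (discreteTopRep H A)) (Q : Fin n → localPoints W (v.adicCompletion ℚ)) (k : ℕ),
      oneCocycleClass (discreteTopRep H A) φ = c ∧ (∀ i, (2 ^ k) • Q i ∈ L) ∧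
      ∀ (τ : localSubgroupOfEmb H (closureEmb (K := ℚ) (v.adicCompletion ℚ))) (i : Fin n),
        pointsMapOfEmb W (closureEmb (K := ℚ) (v.adicCompletion ℚ))
          ((Θ (φ.1 (resGalSubgroupOfEmb H (closureEmb (K := ℚ) (v.adicCompletion ℚ)) τ)) i : ↥(W.geomPrimaryTorsion 2)) :
            W.geomPoints) = (τ : absoluteGaloisGroup (v.adicCompletion ℚ)) • Q i - Q i) :
    ∃ (φ : contOneCocycles (discreteTopRep H A)) (Q : Fin n → localPoints W (v.adicCompletion ℚ)) (k : ℕ),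
      oneCocycleClass (discreteTopRep H A) φ = -c ∧ (∀ i, (2 ^ k) • Q i ∈ L) ∧
      ∀ (τ : localSubgroupOfEmb H (closureEmb (K := ℚ) (v.adicCompletion ℚ))) (i : Fin n),
        pointsMapOfEmb W (closureEmb (K := ℚ) (v.adicCompletion ℚ))
          ((Θ (φ.1 (resGalSubgroupOfEmb H (closureEmb (K := ℚ) (v.adicCompletion ℚ)) τ)) i : ↥(W.geomPrimaryTorsion 2)) :
            W.geomPoints) = (τ : absoluteGaloisGroup (v.adicCompletion ℚ)) • Q i - Q i := by
  obtain ⟨φ, Q, k, hc, hQ, hτ⟩ := h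
  refine ⟨-φ, -Q, k, ?_, fun i ↦ by rw [Pi.neg_apply, smul_neg]; exact L.neg_mem (hQ i), fun τ i ↦ ?_⟩
  · rw [← oneCocycleClassₗ_apply, map_neg, oneCocycleClassₗ_apply, hc]
  · rw [Submodule.coe_neg, ContinuousMap.neg_apply, map_neg, Pi.neg_apply, AddSubgroup.coe_neg, map_neg, hτ,
      Pi.neg_apply, smul_neg]
    abel

omit [W.IsElliptic] [W.IsGloballyMinimal] in
/-- **The transported Kummer clause at `v ∣ 2` cuts out a SUBGROUP of `H¹(H, A)`**, in the crux's form with all conjugates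
`conj_σ`, `σ ∈ Γ_ℚ` (so no definition is needed to speak of "the transported plus condition" as a subgroup): there is an
`AddSubgroup` whose members are exactly the classes `y` with `∀ σ, C_Θ(conj_σ y)`. [cite: Kobayashi2003, Def. 1.1] -/
theorem exists_addSubgroup_transportedKummer [H.Normal] :
    ∃ S : AddSubgroup (subgroupH1 H A), ∀ y, y ∈ S ↔ ∀ σ : absoluteGaloisGroup ℚ,
      ∃ (φ : contOneCocycles (discreteTopRep H A)) (Q : Fin n → localPoints W (v.adicCompletion ℚ)) (k : ℕ),
        oneCocycleClass (discreteTopRep H A) φ = conjH1 H A σ y ∧ (∀ i, (2 ^ k) • Q i ∈ L) ∧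
        ∀ (τ : localSubgroupOfEmb H (closureEmb (K := ℚ) (v.adicCompletion ℚ))) (i : Fin n),
          pointsMapOfEmb W (closureEmb (K := ℚ) (v.adicCompletion ℚ))
            ((Θ (φ.1 (resGalSubgroupOfEmb H (closureEmb (K := ℚ) (v.adicCompletion ℚ)) τ)) i : ↥(W.geomPrimaryTorsion 2)) :
              W.geomPoints) = (τ : absoluteGaloisGroup (v.adicCompletion ℚ)) • Q i - Q i := by
  obtain ⟨P, hP⟩ : ∃ P : subgroupH1 H A → Prop, ∀ y, P y ↔ ∀ σ : absoluteGaloisGroup ℚ,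
      ∃ (φ : contOneCocycles (discreteTopRep H A)) (Q : Fin n → localPoints W (v.adicCompletion ℚ)) (k : ℕ),
        oneCocycleClass (discreteTopRep H A) φ = conjH1 H A σ y ∧ (∀ i, (2 ^ k) • Q i ∈ L) ∧
        ∀ (τ : localSubgroupOfEmb H (closureEmb (K := ℚ) (v.adicCompletion ℚ))) (i : Fin n),
          pointsMapOfEmb W (closureEmb (K := ℚ) (v.adicCompletion ℚ))
            ((Θ (φ.1 (resGalSubgroupOfEmb H (closureEmb (K := ℚ) (v.adicCompletion ℚ)) τ)) i : ↥(W.geomPrimaryTorsion 2)) :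
              W.geomPoints) = (τ : absoluteGaloisGroup (v.adicCompletion ℚ)) • Q i - Q i := ⟨_, fun _ ↦ Iff.rfl⟩
  refine ⟨{ carrier := {y | P y}
            zero_mem' := (hP 0).2 fun σ ↦ by rw [map_zero]; exact transportedKummer_zero W H v Θ L
            add_mem' := fun {y₁ y₂} h₁ h₂ ↦ (hP _).2 fun σ ↦ by
              rw [map_add]; exact transportedKummer_add W H v Θ L _ _ ((hP _).1 h₁ σ) ((hP _).1 h₂ σ)
            neg_mem' := fun {y} h ↦ (hP _).2 fun σ ↦ by
              rw [map_neg]; exact transportedKummer_neg W H v Θ L _ ((hP _).1 h σ) }, fun y ↦ hP y⟩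

end Subgroup

/-! ### §3. `𝒪`-stability -/

section Scalar

variable [TopologicalSpace A] [DiscreteTopology A] {R : Type*} [Semiring R] [Module R A]
  [SMulCommClass (absoluteGaloisGroup ℚ) R A]

/-- **`𝒪`-stability of the transported Kummer clause at `v ∣ 2`** (granted Serre 1972 Prop. 12). On the habitat, for a closed
`H ≤ Γ_ℚ`, a datum `Θ : A ≃+ (W[2^∞])ⁿ` equivariant for the decomposition group at `v`, a subgroup `L` of local points, and a
scalar `r` of `A` commuting with `Γ_ℚ` (e.g. `r ∈ 𝒪` on `A_g = Cofree ρ E`): if the class `c` satisfies the clause then so does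
`scalarH1 r c = [r • φ]` — with `Q' = C·Q`, `C` the integer matrix of `Θ ∘ (r•) ∘ Θ⁻¹` on the finite layer carrying the values of
`Θ ∘ φ` (integral Schur; the cocycle is finitely valued since `H` is compact). [cite: SerreInventiones1972, §1.11 Prop. 12; §2.2]
[cite: EmertonPollackWeston2006, §3.1] [cite: Kobayashi2003, Def. 1.1] -/
theorem transportedKummer_scalarH1 (hSe : serre1972_supersingular_decompositionSubgroup_image)
    (hss : GoodSS W 2) (ha2 : W.frobeniusTrace 2 = 0) (v : HeightOneSpectrum (𝓞 ℚ)) (hv : ((2 : ℕ) : 𝓞 ℚ) ∈ v.asIdeal)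
    (H : Subgroup (absoluteGaloisGroup ℚ)) (hH : IsClosed (H : Set (absoluteGaloisGroup ℚ)))
    {n : ℕ} (Θ : A ≃+ (Fin n → ↥(W.geomPrimaryTorsion 2)))
    (hΘ : ∀ (δ : absoluteGaloisGroup (v.adicCompletion ℚ)) (m : A) (i : Fin n),
      Θ (resGalOfEmb (closureEmb (K := ℚ) (v.adicCompletion ℚ)) δ • m) i =
        resGalOfEmb (closureEmb (K := ℚ) (v.adicCompletion ℚ)) δ • Θ m i)
    (L : AddSubgroup (localPoints W (v.adicCompletion ℚ))) (r : R) (c : subgroupH1 H A)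
    (h : ∃ (φ : contOneCocycles (discreteTopRep H A)) (Q : Fin n → localPoints W (v.adicCompletion ℚ)) (k : ℕ),
      oneCocycleClass (discreteTopRep H A) φ = c ∧ (∀ i, (2 ^ k) • Q i ∈ L) ∧
      ∀ (τ : localSubgroupOfEmb H (closureEmb (K := ℚ) (v.adicCompletion ℚ))) (i : Fin n),
        pointsMapOfEmb W (closureEmb (K := ℚ) (v.adicCompletion ℚ))
          ((Θ (φ.1 (resGalSubgroupOfEmb H (closureEmb (K := ℚ) (v.adicCompletion ℚ)) τ)) i : ↥(W.geomPrimaryTorsion 2)) :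
            W.geomPoints) = (τ : absoluteGaloisGroup (v.adicCompletion ℚ)) • Q i - Q i) :
    ∃ (φ : contOneCocycles (discreteTopRep H A)) (Q : Fin n → localPoints W (v.adicCompletion ℚ)) (k : ℕ),
      oneCocycleClass (discreteTopRep H A) φ = scalarH1 H A r c ∧ (∀ i, (2 ^ k) • Q i ∈ L) ∧
      ∀ (τ : localSubgroupOfEmb H (closureEmb (K := ℚ) (v.adicCompletion ℚ))) (i : Fin n),
        pointsMapOfEmb W (closureEmb (K := ℚ) (v.adicCompletion ℚ))
          ((Θ (φ.1 (resGalSubgroupOfEmb H (closureEmb (K := ℚ) (v.adicCompletion ℚ)) τ)) i : ↥(W.geomPrimaryTorsion 2)) :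
            W.geomPoints) = (τ : absoluteGaloisGroup (v.adicCompletion ℚ)) • Q i - Q i := by
  obtain ⟨φ, Q, k, hc, hQ, hτ⟩ := h
  -- the cocycle `r • φ` represents `scalarH1 r c`
  obtain ⟨φr, hφr, hcl⟩ : ∃ φr : contOneCocycles (discreteTopRep H A), (∀ h, φr.1 h = r • φ.1 h) ∧
      scalarH1 H A r (oneCocycleClass _ φ) = oneCocycleClass _ φr :=
    ⟨_, fun _ ↦ rfl, scalarH1_oneCocycleClass H A r φ⟩
  -- `Ψ = Θ ∘ (r • ·)` is additive and equivariant
  obtain ⟨Ψ, hΨ⟩ : ∃ Ψ : A →+ (Fin n → ↥(W.geomPrimaryTorsion 2)), ∀ m, Ψ m = Θ (r • m) :=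
    ⟨(Θ : A →+ (Fin n → ↥(W.geomPrimaryTorsion 2))).comp (DistribSMul.toAddMonoidHom A r), fun _ ↦ rfl⟩
  have hΨsmul : ∀ (δ : absoluteGaloisGroup (v.adicCompletion ℚ)) (m : A) (i : Fin n),
      Ψ (resGalOfEmb (closureEmb (K := ℚ) (v.adicCompletion ℚ)) δ • m) i =
        resGalOfEmb (closureEmb (K := ℚ) (v.adicCompletion ℚ)) δ • Ψ m i := fun δ m i ↦ by
    rw [hΨ, hΨ, ← smul_comm, hΘ]
  -- finiteness of the cocycle's local values
  haveI : CompactSpace H := isCompact_iff_compactSpace.mp hH.isCompact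
  have hfinφ : (Set.range fun h : H ↦ (φ.1 h : A)).Finite := (isCompact_range φ.1.continuous).finite_of_discrete
  have hfin : (Set.range fun τ : localSubgroupOfEmb H (closureEmb (K := ℚ) (v.adicCompletion ℚ)) ↦
      (φ.1 (resGalSubgroupOfEmb H (closureEmb (K := ℚ) (v.adicCompletion ℚ)) τ) : A)).Finite :=
    hfinφ.subset (by rintro _ ⟨τ, rfl⟩; exact ⟨_, rfl⟩)
  obtain ⟨Q', k', hQ', hτ'⟩ := kummerClause_map_of_kummerClause W hSe hss ha2 v hv Θ Ψ hΘ hΨsmul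
    (fun τ ↦ φ.1 (resGalSubgroupOfEmb H (closureEmb (K := ℚ) (v.adicCompletion ℚ)) τ)) hfin
    (fun τ ↦ (τ : absoluteGaloisGroup (v.adicCompletion ℚ))) L ⟨Q, k, hQ, hτ⟩
  refine ⟨φr, Q', k', by rw [← hcl, hc], hQ', fun τ i ↦ ?_⟩
  rw [hφr, ← hΨ]
  exact hτ' τ i

/-- **`𝒪`-stability in the crux's `conj_σ` form** (granted Serre 1972 Prop. 12): if `∀ σ, C_Θ(conj_σ y)` then
`∀ σ, C_Θ(conj_σ (scalarH1 r y))` (`conj_σ ∘ scalarH1 r = scalarH1 r ∘ conj_σ`, `conjH1_comp_scalarH1`). Together with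
`exists_addSubgroup_transportedKummer` and the tree's stability of `unramifiedOutside` / `infKer` / `scalarH1`-torsion, the `g`-side
counted set of S2 is the `ϖ`-torsion of an `𝒪`-stable subgroup of `H¹(Γ_{ℚ_∞}, A_g)`. [cite: SerreInventiones1972, §1.11 Prop. 12; §2.2]
[cite: EmertonPollackWeston2006, §3.1] -/
theorem transportedKummer_conj_scalarH1 (hSe : serre1972_supersingular_decompositionSubgroup_image)
    (hss : GoodSS W 2) (ha2 : W.frobeniusTrace 2 = 0) (v : HeightOneSpectrum (𝓞 ℚ)) (hv : ((2 : ℕ) : 𝓞 ℚ) ∈ v.asIdeal)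
    (H : Subgroup (absoluteGaloisGroup ℚ)) [H.Normal] (hH : IsClosed (H : Set (absoluteGaloisGroup ℚ)))
    {n : ℕ} (Θ : A ≃+ (Fin n → ↥(W.geomPrimaryTorsion 2)))
    (hΘ : ∀ (δ : absoluteGaloisGroup (v.adicCompletion ℚ)) (m : A) (i : Fin n),
      Θ (resGalOfEmb (closureEmb (K := ℚ) (v.adicCompletion ℚ)) δ • m) i =
        resGalOfEmb (closureEmb (K := ℚ) (v.adicCompletion ℚ)) δ • Θ m i)
    (L : AddSubgroup (localPoints W (v.adicCompletion ℚ))) (r : R) (y : subgroupH1 H A)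
    (h : ∀ σ : absoluteGaloisGroup ℚ,
      ∃ (φ : contOneCocycles (discreteTopRep H A)) (Q : Fin n → localPoints W (v.adicCompletion ℚ)) (k : ℕ),
        oneCocycleClass (discreteTopRep H A) φ = conjH1 H A σ y ∧ (∀ i, (2 ^ k) • Q i ∈ L) ∧
        ∀ (τ : localSubgroupOfEmb H (closureEmb (K := ℚ) (v.adicCompletion ℚ))) (i : Fin n),
          pointsMapOfEmb W (closureEmb (K := ℚ) (v.adicCompletion ℚ))
            ((Θ (φ.1 (resGalSubgroupOfEmb H (closureEmb (K := ℚ) (v.adicCompletion ℚ)) τ)) i : ↥(W.geomPrimaryTorsion 2)) :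
              W.geomPoints) = (τ : absoluteGaloisGroup (v.adicCompletion ℚ)) • Q i - Q i)
    (σ : absoluteGaloisGroup ℚ) :
    ∃ (φ : contOneCocycles (discreteTopRep H A)) (Q : Fin n → localPoints W (v.adicCompletion ℚ)) (k : ℕ),
      oneCocycleClass (discreteTopRep H A) φ = conjH1 H A σ (scalarH1 H A r y) ∧ (∀ i, (2 ^ k) • Q i ∈ L) ∧
      ∀ (τ : localSubgroupOfEmb H (closureEmb (K := ℚ) (v.adicCompletion ℚ))) (i : Fin n),
        pointsMapOfEmb W (closureEmb (K := ℚ) (v.adicCompletion ℚ))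
          ((Θ (φ.1 (resGalSubgroupOfEmb H (closureEmb (K := ℚ) (v.adicCompletion ℚ)) τ)) i : ↥(W.geomPrimaryTorsion 2)) :
            W.geomPoints) = (τ : absoluteGaloisGroup (v.adicCompletion ℚ)) • Q i - Q i := by
  have hcomm : conjH1 H A σ (scalarH1 H A r y) = scalarH1 H A r (conjH1 H A σ y) := by
    rw [← AddMonoidHom.comp_apply, conjH1_comp_scalarH1, AddMonoidHom.comp_apply]
  rw [hcomm]
  exact transportedKummer_scalarH1 W hSe hss ha2 v hv H hH Θ hΘ L r _ (h σ)

end Scalar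

end Summit.BirchSwinnertonDyer.BirchSwinnertonDyer.Theorems.ThetaTransport

end
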